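import Mathlib

/-!
# Short even cycles are gadgets (crux `HyperoctahedralThreshold`, refutation line, lead c3)

A *host* is a triple of involutions `μ 0, μ 1, μ 2` ("colours") on `Fin n`.  A simple closed walk
`x 0 → x 1 → ⋯ → x (L - 1) → x 0` (`x` injective) whose `i`-th edge `{x i, x (i + 1)}` has colour `c i`
(`μ (c i) (x i) = x (i + 1)`, indices mod `L`), with cyclically distinct consecutive colours, is a *short
even cycle* for `L = 4` or `L = 6`.  `stub_shortEvenCycleGadget` (crux NOTES §15.7): every short even
cycle carries a *clean closed rung-walk* of length `≤ 6` using only its own edges — `k + 1` rungs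
`(p i, q i)` with distinct endpoints on the cycle, step `i` of colour `col i` mapping rung `i` onto rung
`i + 1` (parallel or crossed, indices mod `k + 1`), consecutive colours distinct cyclically, and any two
rungs equal or disjoint as `2`-sets (the data format of the line's open core, minus the forbidden set).

Recipes.  `L = 4`, colours `c₀c₁c₂c₃`: over three colours necessarily `c r = c (r + 2)` for some `r`
(`colour_four`); after re-indexing the cycle by `r`, the rungs `{x 1, x 2}, {x 1, x 2}, {x 0, x 3},
{x 0, x 3}` with step colours `c 1, c 0, c 3, c 0` work (`gadget_four`).  `L = 6`: necessarily a
reflection `c r = c (r + 4), c (r + 1) = c (r + 3)` or the antipodal pattern `c i = c (i + 3)`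
(`colour_six`); in the first case (`gadget_six_reflect`, after re-indexing by `r`) the six rungs
`{x 2, x 3}, {x 2, x 3}, {x 1, x 4}, {x 0, x 5}, {x 0, x 5}, {x 1, x 4}` with step colours
`c 2, c 1, c 0, c 5, c 0, c 1`; in the second (`gadget_six_antipodal`) the Möbius walk on the three
antipodal rungs `{x i, x (i + 3)}` with step colours `c 0, c 1, c 2` (last step crossed).
Pure finite combinatorics; only `μ c * μ c = 1` is used.  No definitions are introduced.
-/

set_option linter.dupNamespace false

namespace Summit.MatrixMultiplication.MatrixMultiplication.Theorems.HyperoctahedralThreshold.ShortCycle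

variable {n : ℕ}

/-- Colour words of a `4`-cycle: cyclically distinct consecutive letters over `Fin 3` force a repeat at
distance `2`. -/
theorem colour_four (c₀ c₁ c₂ c₃ : Fin 3) (h₀ : c₀ ≠ c₁) (h₁ : c₁ ≠ c₂) (h₂ : c₂ ≠ c₃) (h₃ : c₃ ≠ c₀) :
    c₀ = c₂ ∨ c₁ = c₃ := by
  revert c₀ c₁ c₂ c₃
  decide

/-- Colour words of a `6`-cycle: cyclically distinct consecutive letters over `Fin 3` force a reflection
pattern `c r = c (r + 4), c (r + 1) = c (r + 3)` (listed for `r = 0, …, 5`) or the antipodal pattern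
`c i = c (i + 3)`. -/
theorem colour_six (c₀ c₁ c₂ c₃ c₄ c₅ : Fin 3) (h₀ : c₀ ≠ c₁) (h₁ : c₁ ≠ c₂) (h₂ : c₂ ≠ c₃)
    (h₃ : c₃ ≠ c₄) (h₄ : c₄ ≠ c₅) (h₅ : c₅ ≠ c₀) :
    (c₀ = c₄ ∧ c₁ = c₃) ∨ (c₁ = c₅ ∧ c₂ = c₄) ∨ (c₂ = c₀ ∧ c₃ = c₅) ∨ (c₃ = c₁ ∧ c₄ = c₀) ∨
      (c₄ = c₂ ∧ c₅ = c₁) ∨ (c₅ = c₃ ∧ c₀ = c₂) ∨ (c₀ = c₃ ∧ c₁ = c₄ ∧ c₂ = c₅) := by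
  revert c₀ c₁ c₂ c₃ c₄ c₅
  decide

/-- An involution undoes itself pointwise. -/
theorem inv_apply (μ : Fin 3 → Equiv.Perm (Fin n)) (hμ : ∀ c, μ c * μ c = 1) (d : Fin 3)
    (v : Fin n) : μ d (μ d v) = v := by
  rw [← Equiv.Perm.mul_apply, hμ d, Equiv.Perm.one_apply]

/-- **The `4`-cycle gadget.**  A simple closed `4`-walk whose colour word repeats at distance `2` from
position `r` carries a clean closed rung-walk of length `4` on its own edges: after re-indexing by `r`,
rungs `{x 1, x 2}, {x 1, x 2}, {x 0, x 3}, {x 0, x 3}` and step colours `c 1, c 0, c 3, c 0`. -/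
theorem gadget_four (μ : Fin 3 → Equiv.Perm (Fin n)) (hμ : ∀ c, μ c * μ c = 1) (x : Fin 4 → Fin n)
    (c : Fin 4 → Fin 3) (hx : Function.Injective x) (hw : ∀ i, μ (c i) (x i) = x (i + 1))
    (hc : ∀ i, c i ≠ c (i + 1)) (r : Fin 4) (hr : c r = c (r + 2)) :
    ∃ (p q : Fin 4 → Fin n) (col : Fin 4 → Fin 3), (∀ i, p i ≠ q i) ∧
      (∀ i, (μ (col i) (p i) = p (i + 1) ∧ μ (col i) (q i) = q (i + 1)) ∨
        (μ (col i) (p i) = q (i + 1) ∧ μ (col i) (q i) = p (i + 1))) ∧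
      (∀ i, col i ≠ col (i + 1)) ∧
      (∀ i j, (p i = p j ∧ q i = q j) ∨ (p i = q j ∧ q i = p j) ∨
        (p i ≠ p j ∧ p i ≠ q j ∧ q i ≠ p j ∧ q i ≠ q j)) ∧
      (∀ i, (∃ j, p i = x j) ∧ (∃ j, q i = x j)) := by
  -- re-index the cycle by `r`: `y i = x (i + r)`, `d i = c (i + r)`
  obtain ⟨y, hy⟩ : ∃ y : Fin 4 → Fin n, ∀ i, y i = x (i + r) := ⟨_, fun _ => rfl⟩
  obtain ⟨d, hd⟩ : ∃ d : Fin 4 → Fin 3, ∀ i, d i = c (i + r) := ⟨_, fun _ => rfl⟩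
  have hyi : Function.Injective y := by
    intro i j h
    rw [hy, hy] at h
    exact add_right_cancel (hx h)
  have hf : ∀ i, μ (d i) (y i) = y (i + 1) := fun i => by
    rw [hd, hy, hy, hw, add_right_comm]
  have hb : ∀ i, μ (d i) (y (i + 1)) = y i := fun i => by
    rw [← hf, inv_apply μ hμ]
  have hdc : ∀ i, d i ≠ d (i + 1) := fun i => by
    rw [hd, hd, add_right_comm]
    exact hc (i + r)
  have h02 : d 0 = d 2 := by
    rw [hd, hd]
    simpa [add_comm] using hr
  have hmem : ∀ i, ∃ j, y i = x j := fun i => ⟨i + r, hy i⟩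
  -- the eight oriented edges, the colour `d 2` renamed `d 0`
  have f0 : μ (d 0) (y 0) = y 1 := by simpa using hf 0
  have f1 : μ (d 1) (y 1) = y 2 := by simpa using hf 1
  have f2 : μ (d 0) (y 2) = y 3 := by rw [h02]; simpa using hf 2
  have f3 : μ (d 3) (y 3) = y 0 := by simpa using hf 3
  have b0 : μ (d 0) (y 1) = y 0 := by simpa using hb 0
  have b1 : μ (d 1) (y 2) = y 1 := by simpa using hb 1
  have b2 : μ (d 0) (y 3) = y 2 := by rw [h02]; simpa using hb 2
  have b3 : μ (d 3) (y 0) = y 3 := by simpa using hb 3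
  have c01 : d 0 ≠ d 1 := by simpa using hdc 0
  have c30 : d 3 ≠ d 0 := by simpa using hdc 3
  refine ⟨![y 1, y 2, y 3, y 0], ![y 2, y 1, y 0, y 3], ![d 1, d 0, d 3, d 0], ?_, ?_, ?_, ?_, ?_⟩
  · intro i
    fin_cases i <;> simp [hyi.eq_iff]
  · intro i
    fin_cases i <;> simp [f0, f1, f2, f3, b0, b1, b2, b3]
  · intro i
    fin_cases i <;> simp [c01, c01.symm, c30, c30.symm]
  · intro i j
    fin_cases i <;> fin_cases j <;> simp [hyi.eq_iff]
  · intro i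
    fin_cases i <;> exact ⟨hmem _, hmem _⟩

/-- **The `6`-cycle gadget, reflection case.**  A simple closed `6`-walk whose colour word satisfies
`c r = c (r + 4)` and `c (r + 1) = c (r + 3)` carries a clean closed rung-walk of length `6` on its own
edges: after re-indexing by `r`, rungs `{x 2, x 3}, {x 2, x 3}, {x 1, x 4}, {x 0, x 5}, {x 0, x 5},
{x 1, x 4}` and step colours `c 2, c 1, c 0, c 5, c 0, c 1`. -/
theorem gadget_six_reflect (μ : Fin 3 → Equiv.Perm (Fin n)) (hμ : ∀ c, μ c * μ c = 1)
    (x : Fin 6 → Fin n) (c : Fin 6 → Fin 3) (hx : Function.Injective x)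
    (hw : ∀ i, μ (c i) (x i) = x (i + 1)) (hc : ∀ i, c i ≠ c (i + 1)) (r : Fin 6)
    (hr : c r = c (r + 4)) (hr' : c (r + 1) = c (r + 3)) :
    ∃ (p q : Fin 6 → Fin n) (col : Fin 6 → Fin 3), (∀ i, p i ≠ q i) ∧
      (∀ i, (μ (col i) (p i) = p (i + 1) ∧ μ (col i) (q i) = q (i + 1)) ∨
        (μ (col i) (p i) = q (i + 1) ∧ μ (col i) (q i) = p (i + 1))) ∧
      (∀ i, col i ≠ col (i + 1)) ∧
      (∀ i j, (p i = p j ∧ q i = q j) ∨ (p i = q j ∧ q i = p j) ∨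
        (p i ≠ p j ∧ p i ≠ q j ∧ q i ≠ p j ∧ q i ≠ q j)) ∧
      (∀ i, (∃ j, p i = x j) ∧ (∃ j, q i = x j)) := by
  -- re-index the cycle by `r`: `y i = x (i + r)`, `d i = c (i + r)`
  obtain ⟨y, hy⟩ : ∃ y : Fin 6 → Fin n, ∀ i, y i = x (i + r) := ⟨_, fun _ => rfl⟩
  obtain ⟨d, hd⟩ : ∃ d : Fin 6 → Fin 3, ∀ i, d i = c (i + r) := ⟨_, fun _ => rfl⟩
  have hyi : Function.Injective y := by
    intro i j h
    rw [hy, hy] at h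
    exact add_right_cancel (hx h)
  have hf : ∀ i, μ (d i) (y i) = y (i + 1) := fun i => by
    rw [hd, hy, hy, hw, add_right_comm]
  have hb : ∀ i, μ (d i) (y (i + 1)) = y i := fun i => by
    rw [← hf, inv_apply μ hμ]
  have hdc : ∀ i, d i ≠ d (i + 1) := fun i => by
    rw [hd, hd, add_right_comm]
    exact hc (i + r)
  have h04 : d 0 = d 4 := by
    rw [hd, hd]
    simpa [add_comm] using hr
  have h13 : d 1 = d 3 := by
    rw [hd, hd]
    simpa [add_comm] using hr'
  have hmem : ∀ i, ∃ j, y i = x j := fun i => ⟨i + r, hy i⟩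
  -- the twelve oriented edges, the colours `d 4, d 3` renamed `d 0, d 1`
  have f0 : μ (d 0) (y 0) = y 1 := by simpa using hf 0
  have f1 : μ (d 1) (y 1) = y 2 := by simpa using hf 1
  have f2 : μ (d 2) (y 2) = y 3 := by simpa using hf 2
  have f3 : μ (d 1) (y 3) = y 4 := by rw [h13]; simpa using hf 3
  have f4 : μ (d 0) (y 4) = y 5 := by rw [h04]; simpa using hf 4
  have f5 : μ (d 5) (y 5) = y 0 := by simpa using hf 5
  have b0 : μ (d 0) (y 1) = y 0 := by simpa using hb 0
  have b1 : μ (d 1) (y 2) = y 1 := by simpa using hb 1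
  have b2 : μ (d 2) (y 3) = y 2 := by simpa using hb 2
  have b3 : μ (d 1) (y 4) = y 3 := by rw [h13]; simpa using hb 3
  have b4 : μ (d 0) (y 5) = y 4 := by rw [h04]; simpa using hb 4
  have b5 : μ (d 5) (y 0) = y 5 := by simpa using hb 5
  have c01 : d 0 ≠ d 1 := by simpa using hdc 0
  have c12 : d 1 ≠ d 2 := by simpa using hdc 1
  have c50 : d 5 ≠ d 0 := by simpa using hdc 5
  refine ⟨![y 2, y 3, y 4, y 5, y 0, y 1], ![y 3, y 2, y 1, y 0, y 5, y 4],
    ![d 2, d 1, d 0, d 5, d 0, d 1], ?_, ?_, ?_, ?_, ?_⟩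
  · intro i
    fin_cases i <;> simp [hyi.eq_iff]
  · intro i
    fin_cases i <;> simp [f0, f1, f2, f3, f4, f5, b0, b1, b2, b3, b4, b5]
  · intro i
    fin_cases i <;> simp [c01, c01.symm, c12, c12.symm, c50, c50.symm]
  · intro i j
    fin_cases i <;> fin_cases j <;> simp [hyi.eq_iff]
  · intro i
    fin_cases i <;> exact ⟨hmem _, hmem _⟩

/-- **The `6`-cycle gadget, antipodal case** (Möbius walk).  A simple closed `6`-walk with
`c i = c (i + 3)` carries a clean closed rung-walk of length `3` on its own edges: the antipodal rungs
`{x 0, x 3}, {x 1, x 4}, {x 2, x 5}` with step colours `c 0, c 1, c 2`, the last step crossed. -/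
theorem gadget_six_antipodal (μ : Fin 3 → Equiv.Perm (Fin n)) (x : Fin 6 → Fin n) (c : Fin 6 → Fin 3)
    (hx : Function.Injective x) (hw : ∀ i, μ (c i) (x i) = x (i + 1)) (hc : ∀ i, c i ≠ c (i + 1))
    (h₀ : c 0 = c 3) (h₁ : c 1 = c 4) (h₂ : c 2 = c 5) :
    ∃ (p q : Fin 3 → Fin n) (col : Fin 3 → Fin 3), (∀ i, p i ≠ q i) ∧
      (∀ i, (μ (col i) (p i) = p (i + 1) ∧ μ (col i) (q i) = q (i + 1)) ∨
        (μ (col i) (p i) = q (i + 1) ∧ μ (col i) (q i) = p (i + 1))) ∧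
      (∀ i, col i ≠ col (i + 1)) ∧
      (∀ i j, (p i = p j ∧ q i = q j) ∨ (p i = q j ∧ q i = p j) ∨
        (p i ≠ p j ∧ p i ≠ q j ∧ q i ≠ p j ∧ q i ≠ q j)) ∧
      (∀ i, (∃ j, p i = x j) ∧ (∃ j, q i = x j)) := by
  -- the six forward edges, the colours `c 3, c 4, c 5` renamed `c 0, c 1, c 2`
  have f0 : μ (c 0) (x 0) = x 1 := by simpa using hw 0
  have f1 : μ (c 1) (x 1) = x 2 := by simpa using hw 1
  have f2 : μ (c 2) (x 2) = x 3 := by simpa using hw 2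
  have f3 : μ (c 0) (x 3) = x 4 := by rw [h₀]; simpa using hw 3
  have f4 : μ (c 1) (x 4) = x 5 := by rw [h₁]; simpa using hw 4
  have f5 : μ (c 2) (x 5) = x 0 := by rw [h₂]; simpa using hw 5
  have c01 : c 0 ≠ c 1 := by simpa using hc 0
  have c12 : c 1 ≠ c 2 := by simpa using hc 1
  have c20 : c 2 ≠ c 0 := by rw [h₀]; simpa using hc 2
  refine ⟨![x 0, x 1, x 2], ![x 3, x 4, x 5], ![c 0, c 1, c 2], ?_, ?_, ?_, ?_, ?_⟩
  · intro i
    fin_cases i <;> simp [hx.eq_iff]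
  · intro i
    fin_cases i <;> simp [f0, f1, f2, f3, f4, f5, hx.eq_iff]
  · intro i
    fin_cases i <;> simp [c01, c12, c20]
  · intro i j
    fin_cases i <;> fin_cases j <;> simp [hx.eq_iff]
  · intro i
    fin_cases i <;> exact ⟨⟨_, rfl⟩, ⟨_, rfl⟩⟩

/-- **Short even cycles are gadgets** (`stub_shortEvenCycleGadget`, a `--supports` sub-goal of crux
`stmt-MatrixMultiplication-10883`, crux NOTES §15.7): in a host of three involutions on `Fin n`, every
simple closed `4`-walk and every simple closed `6`-walk with cyclically distinct consecutive colours
carries a clean closed rung-walk of length `≤ 6` all of whose rung endpoints lie on the walk. -/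
theorem stub_shortEvenCycleGadget : ∀ (n : ℕ) (μ : Fin 3 → Equiv.Perm (Fin n)), (∀ c, μ c * μ c = 1) → (∀ (x : Fin 4 → Fin n) (c : Fin 4 → Fin 3), Function.Injective x → (∀ i, μ (c i) (x i) = x (i + 1)) → (∀ i, c i ≠ c (i + 1)) → ∃ (k : ℕ) (p q : Fin (k + 1) → Fin n) (col : Fin (k + 1) → Fin 3), (∀ i, p i ≠ q i) ∧ (∀ i, (μ (col i) (p i) = p (i + 1) ∧ μ (col i) (q i) = q (i + 1)) ∨ (μ (col i) (p i) = q (i + 1) ∧ μ (col i) (q i) = p (i + 1))) ∧ (∀ i, col i ≠ col (i + 1)) ∧ (∀ i j, (p i = p j ∧ q i = q j) ∨ (p i = q j ∧ q i = p j) ∨ (p i ≠ p j ∧ p i ≠ q j ∧ q i ≠ p j ∧ q i ≠ q j)) ∧ (∀ i, (∃ j, p i = x j) ∧ (∃ j, q i = x j)) ∧ k + 1 ≤ 6) ∧ (∀ (x : Fin 6 → Fin n) (c : Fin 6 → Fin 3), Function.Injective x → (∀ i, μ (c i) (x i) = x (i + 1)) → (∀ i, c i ≠ c (i + 1)) → ∃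 (k : ℕ) (p q : Fin (k + 1) → Fin n) (col : Fin (k + 1) → Fin 3), (∀ i, p i ≠ q i) ∧ (∀ i, (μ (col i) (p i) = p (i + 1) ∧ μ (col i) (q i) = q (i + 1)) ∨ (μ (col i) (p i) = q (i + 1) ∧ μ (col i) (q i) = p (i + 1))) ∧ (∀ i, col i ≠ col (i + 1)) ∧ (∀ i j, (p i = p j ∧ q i = q j) ∨ (p i = q j ∧ q i = p j) ∨ (p i ≠ p j ∧ p i ≠ q j ∧ q i ≠ p j ∧ q i ≠ q j)) ∧ (∀ i, (∃ j, p i = x j) ∧ (∃ j, q i = x j)) ∧ k + 1 ≤ 6) := by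
  intro n μ hμ
  refine ⟨fun x c hx hw hc => ?_, fun x c hx hw hc => ?_⟩
  · -- `L = 4`: a colour repeats at distance `2`
    obtain ⟨r, hr⟩ : ∃ r : Fin 4, c r = c (r + 2) := by
      rcases colour_four (c 0) (c 1) (c 2) (c 3) (by simpa using hc 0) (by simpa using hc 1)
          (by simpa using hc 2) (by simpa using hc 3) with h | h
      · exact ⟨0, by simpa using h⟩
      · exact ⟨1, by simpa using h⟩
    obtain ⟨p, q, col, h1, h2, h3, h4, h5⟩ := gadget_four μ hμ x c hx hw hc r hr
    exact ⟨3, p, q, col, h1, h2, h3, h4, h5, by norm_num⟩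
  · -- `L = 6`: reflection or antipodal colour pattern
    obtain ⟨r, hr, hr'⟩ | ⟨h₀, h₁, h₂⟩ :
        (∃ r : Fin 6, c r = c (r + 4) ∧ c (r + 1) = c (r + 3)) ∨
          (c 0 = c 3 ∧ c 1 = c 4 ∧ c 2 = c 5) := by
      rcases colour_six (c 0) (c 1) (c 2) (c 3) (c 4) (c 5) (by simpa using hc 0)
          (by simpa using hc 1) (by simpa using hc 2) (by simpa using hc 3) (by simpa using hc 4)
          (by simpa using hc 5) with
          ⟨h, h'⟩ | ⟨h, h'⟩ | ⟨h, h'⟩ | ⟨h, h'⟩ | ⟨h, h'⟩ | ⟨h, h'⟩ | h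
      · exact Or.inl ⟨0, by simpa using h, by simpa using h'⟩
      · exact Or.inl ⟨1, by simpa using h, by simpa using h'⟩
      · exact Or.inl ⟨2, by simpa using h, by simpa using h'⟩
      · exact Or.inl ⟨3, by simpa using h, by simpa using h'⟩
      · exact Or.inl ⟨4, by simpa using h, by simpa using h'⟩
      · exact Or.inl ⟨5, by simpa using h, by simpa using h'⟩
      · exact Or.inr h
    · obtain ⟨p, q, col, h1, h2, h3, h4, h5⟩ := gadget_six_reflect μ hμ x c hx hw hc r hr hr'
      exact ⟨5, p, q, col, h1, h2, h3, h4, h5, by norm_num⟩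
    · obtain ⟨p, q, col, h1, h2, h3, h4, h5⟩ := gadget_six_antipodal μ x c hx hw hc h₀ h₁ h₂
      exact ⟨2, p, q, col, h1, h2, h3, h4, h5, by norm_num⟩

end Summit.MatrixMultiplication.MatrixMultiplication.Theorems.HyperoctahedralThreshold.ShortCycle
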